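import Literature.NumberTheory.EllipticCurves.GreenbergSelmerDualDataExistsProofs
import Literature.NumberTheory.EllipticCurves.IwasawaSelmerDualProofs
import HarnessLib

/-!
# Route `TwoAdicConverse` (rung S3), crux `OrdLambdaHalfAtTwo` (item stmt-BirchSwinnertonDyer-19556), line
# `kato-determinant-greenberg-two`: carrier D1 — the Pontryagin dual of a Greenberg STRICT Selmer group
# `Sel^{str}_L(K_∞, M)` for an ARBITRARY discrete `p`-primary `Γ_K`-module `M`, as a `Λ`-module (hypothesis structure
# + EXISTENCE)

Seat `cruxlead-stmt-BirchSwinnertonDyer-19556-g1` (LEAD PROVER, MODE LINE; `--supports` stmt-BirchSwinnertonDyer-19556, helper).  HONEST FRAMING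
(cell bsd-2adic): BSD is not proved by any of this; the crux is NOT proved here; nothing about any particular curve or field is asserted; one
hypothesis structure whose inhabitation is PROVED here, definitions with bodies; no named fact, no instance, no `sorry`.

WHY (pen RC-344, lead g1 RECUT memo 2 / HANDOFF «D1»): the `GL(1)` split of stub 6′ of the line (`6b`: the cyclotomic-line `GL(1)` main
conjecture for `X_w(K^cyc_∞)` at `2`; `B3a`: the exact dévissage formula for `λ(X_Gr)`) needs a CARRIER for the `GL(1)` Iwasawa modules of
the imaginary quadratic field `K` over its cyclotomic `ℤ₂`-tower with Greenberg–BDP local conditions — e.g. `X_w(K^cyc_∞)` = the Pontryagin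
dual of `Sel^{str}_{bdpData}(K_∞, ℚ₂/ℤ₂)` (trivial action; strict = split at `w`, relaxed at `w̄`, trivial at `η ∤ 2`), and the residual
modules `M ∈ {Φ, E[2]/Φ, E[2]}`.  The tree's `WeierstrassCurve.GreenbergStrictSelmerDualData` (p656787) is this object for `M = E[p^∞]`
ONLY; none of the tree's fifteen `…DualData` structures is module-generic.  This file is the WORD-FOR-WORD generalisation of
`GreenbergStrictSelmerDualProofs.lean` to an arbitrary discrete `Γ_K`-module `M` that is `p`-primary (`htor`) with open point stabilisers
(`hstab`) — using the tree's generic inputs `GreenbergSelmer.exists_pow_smul_subgroupH1_eq_zero` (P) and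
`GreenbergSelmer.exists_conjH1_pow_prime_pow_eq` (A2) (`GreenbergSelmerDualDataExistsProofs.lean`) and `IwasawaDual.IsLocNil.module`.

* §1 `GreenbergStrictSelmerDualDataOf κ γ M L` — abstract `Λ = ℤ_p⟦T⟧`-module `X`, bijective `toDual : X → Hom(Sel^{str}_L(K_∞, M), ℚ/ℤ)`,
  `T = conj_γ − 1`, constants through `ℤ/p^k` on `p^k`-torsion classes (nothing asserted).
* §2 `conjStrictSelmerInftyOf` (`conj_γ` restricted; `GreenbergSelmer.conjH1_mem_strictSelmerGroupOver`), local nilpotence, and the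
  CONSTRUCTION `greenbergStrictSelmerDualDataOf` with `nonempty_…` — existence for every `κ`, topological generator `γ`, data `L`, and
  every such `M`.

References: R. Greenberg, Adv. Stud. Pure Math. 17 (1989) §1 p. 98 [Greenberg1989]; R. Greenberg, LNM 1716 (1999) §1 [GreenbergLNM1716];
L. Washington, GTM 83 §13.2 [Washington1997].
-/

set_option linter.dupNamespace false
set_option autoImplicit false

noncomputable section

open scoped Classical

open Literature.NumberTheory.EllipticCurves Literature.NumberTheory.EllipticCurves.IwasawaAlgebra
  Literature.NumberTheory.EllipticCurves.IwasawaDual Literature.NumberTheory.EllipticCurves.ZpExtension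
  Literature.NumberTheory.GaloisRepresentations Field

universe u

namespace Summit.BirchSwinnertonDyer.BirchSwinnertonDyer.Theorems.TwoAdicKatoDeterminant

variable {K : Type u} [Field K] [NumberField K] {p : ℕ} [Fact p.Prime]
  (κ : ZpExtension K p) (γ : absoluteGaloisGroup K)
  (M : Type u) [AddCommGroup M] [DistribMulAction (absoluteGaloisGroup K) M] [TopologicalSpace M] [DiscreteTopology M]
  (L : GreenbergSelmer.Data K M p)

/-! ## §1 The hypothesis structure -/

/-- **Pontryagin-dual data for a Greenberg strict Selmer group `Sel^{str}_L(K_∞, M)` of an ARBITRARY discrete `Γ_K`-module `M`**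
(module-generic form of `WeierstrassCurve.GreenbergStrictSelmerDualData`): the Iwasawa module `X = Hom(Sel^{str}_L(K_∞, M), ℚ/ℤ)` as an
abstract `Λ = ℤ_p⟦T⟧`-module with a bijective additive `toDual`, `T` acting as `conj_γ − 1` (the strict Selmer group is `conj`-stable by
`GreenbergSelmer.conjH1_mem_strictSelmerGroupOver`) and constants `c ∈ ℤ_p` acting on `p^k`-torsion classes through `ℤ_p → ℤ/p^k`.  For
`M = ℚ_p/ℤ_p` with trivial action and `L = bdpData` this is the `GL(1)` Iwasawa module «`X_w(K_∞)`» (Galois group of the maximal abelian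
pro-`p` extension of `K_∞` split above `w`, arbitrary above `w̄`, trivial=unramified at the other places).  Nothing asserted; existence is
`nonempty_greenbergStrictSelmerDualDataOf` below. [cite: Greenberg1989, §1 p. 98] [cite: GreenbergLNM1716, §1 (after Conj. 1.3)] -/
structure GreenbergStrictSelmerDualDataOf where
  /-- The underlying type of the Iwasawa module `X = Hom(Sel^{str}_L(K_∞, M), ℚ/ℤ)`. -/
  X : Type u
  /-- `X` is an abelian group. -/
  [addCommGroup : AddCommGroup X]
  /-- `X` is a `Λ = ℤ_p⟦T⟧`-module. -/
  [module : Module (IwasawaAlgebra p) X]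
  /-- The identification of `X` with the character group `Hom(Sel^{str}_L(K_∞, M), ℚ/ℤ)`. -/
  toDual : X →+ (GreenbergSelmer.strictSelmerInfty κ M L →+ AddCircle (1 : ℚ))
  /-- `toDual` is a group isomorphism. -/
  bijective : Function.Bijective toDual
  /-- `T` acts as `γ - 1`: `(T·x)(s) = x(conj_γ s) - x(s)`. -/
  toDual_T_smul : ∀ (x : X) (s : GreenbergSelmer.strictSelmerInfty κ M L),
    toDual ((PowerSeries.X : IwasawaAlgebra p) • x) s =
      toDual x ⟨conjH1 κ.kerSubgroup M γ s, GreenbergSelmer.conjH1_mem_strictSelmerGroupOver γ s.2⟩ - toDual x s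
  /-- Constants `c ∈ ℤ_p` act on `p^k`-torsion classes through `ℤ_p → ℤ/p^k`. -/
  toDual_C_smul : ∀ (c : ℤ_[p]) (x : X) (s : GreenbergSelmer.strictSelmerInfty κ M L) (k : ℕ), (p ^ k) • s = 0 →
    toDual (PowerSeries.C c • x) s = (PadicInt.toZModPow k c).val • toDual x s

attribute [instance] GreenbergStrictSelmerDualDataOf.addCommGroup GreenbergStrictSelmerDualDataOf.module

/-! ## §2 Construction -/

/-- `conj_γ` restricted to an endomorphism of `Sel^{str}_L(K_∞, M)`. [cite: Greenberg1989, §1 p. 98] -/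
def conjStrictSelmerInftyOf : AddMonoid.End (GreenbergSelmer.strictSelmerInfty κ M L) :=
  ((conjH1 κ.kerSubgroup M γ).restrict (GreenbergSelmer.strictSelmerInfty κ M L)).codRestrict
    (GreenbergSelmer.strictSelmerInfty κ M L) fun s ↦ GreenbergSelmer.conjH1_mem_strictSelmerGroupOver γ s.2

/-- Unfolding `conjStrictSelmerInftyOf` (definitional). [cite: Greenberg1989, §1 p. 98] -/
@[simp]
theorem coe_conjStrictSelmerInftyOf_apply (s : GreenbergSelmer.strictSelmerInfty κ M L) :
    ((conjStrictSelmerInftyOf κ γ M L s : GreenbergSelmer.strictSelmerInfty κ M L) : subgroupH1 κ.kerSubgroup M) =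
      conjH1 κ.kerSubgroup M γ s :=
  rfl

/-- Powers of the restriction are restrictions of `conj_{γ^m}` (`conjH1_one_holds`, `conjH1_mul_holds`).
[cite: GreenbergLNM1716, §1 (after Conj. 1.3)] -/
theorem coe_conjStrictSelmerInftyOf_pow_apply (m : ℕ) (s : GreenbergSelmer.strictSelmerInfty κ M L) :
    ((((conjStrictSelmerInftyOf κ γ M L) ^ m) s : GreenbergSelmer.strictSelmerInfty κ M L) : subgroupH1 κ.kerSubgroup M) =
      conjH1 κ.kerSubgroup M (γ ^ m) s := by
  induction m generalizing s with
  | zero => rw [pow_zero, pow_zero, AddMonoid.End.one_apply, conjH1_one_holds κ.kerSubgroup M, AddMonoidHom.id_apply]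
  | succ m ih =>
    rw [pow_succ, AddMonoid.End.coe_mul, Function.comp_apply, ih, coe_conjStrictSelmerInftyOf_apply, pow_succ,
      conjH1_mul_holds κ.kerSubgroup M, AddMonoidHom.comp_apply]

variable {γ M} in
/-- **`Sel^{str}_L(K_∞, M)` is `p`-primary and `T = γ − 1` is locally nilpotent on it**, for `M` `p`-primary with open point stabilisers
and `γ` a topological generator (tree: (P) `GreenbergSelmer.exists_pow_smul_subgroupH1_eq_zero`, (A2) `GreenbergSelmer.exists_conjH1_pow_prime_pow_eq`,
`IwasawaDual.pow_mul_prime_pow_apply_eq_zero`). [cite: GreenbergLNM1716, §1 (after Conj. 1.3)] -/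
theorem isLocNil_conjStrictSelmerInftyOf_sub_one (htor : ∀ m : M, ∃ k : ℕ, p ^ k • m = 0)
    (hstab : ∀ m : M, IsOpen (MulAction.stabilizer (absoluteGaloisGroup K) m : Set (absoluteGaloisGroup K)))
    (hγ : κ.IsTopGenerator γ) :
    IwasawaDual.IsLocNil p (conjStrictSelmerInftyOf κ γ M L - 1) := by
  have htor' : ∀ s : GreenbergSelmer.strictSelmerInfty κ M L, ∃ k : ℕ, p ^ k • s = 0 := fun s ↦ by
    obtain ⟨k, hk⟩ := GreenbergSelmer.exists_pow_smul_subgroupH1_eq_zero κ M htor (s : subgroupH1 κ.kerSubgroup M)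
    exact ⟨k, Subtype.ext (by rw [AddSubgroupClass.coe_nsmul]; exact hk)⟩
  refine ⟨htor', fun s ↦ ?_⟩
  obtain ⟨a, ha⟩ := GreenbergSelmer.exists_conjH1_pow_prime_pow_eq κ M hstab hγ (s : subgroupH1 κ.kerSubgroup M)
  obtain ⟨k, hk⟩ := htor' s
  have hφ : ((conjStrictSelmerInftyOf κ γ M L) ^ p ^ a) s = s :=
    Subtype.ext (by rw [coe_conjStrictSelmerInftyOf_pow_apply]; exact ha)
  exact ⟨k * p ^ a, IwasawaDual.pow_mul_prime_pow_apply_eq_zero (Fact.out : p.Prime) _ a hφ hk⟩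

variable {γ M} in
/-- **The dual `X = Hom(Sel^{str}_L(K_∞, M), ℚ/ℤ)` with its `Λ`-module structure** (`T = γ − 1`, constants through `ℤ_p → ℤ/p^k`) packaged
as `GreenbergStrictSelmerDualDataOf κ γ M L` — word for word the tree's `greenbergStrictSelmerDualData` (`X = Sel →+ AddCircle 1`, `toDual = id`,
module structure `IsLocNil.module`). [cite: Greenberg1989, §1 p. 98] [cite: GreenbergLNM1716, §1 (after Conj. 1.3)] -/
def greenbergStrictSelmerDualDataOf (htor : ∀ m : M, ∃ k : ℕ, p ^ k • m = 0)
    (hstab : ∀ m : M, IsOpen (MulAction.stabilizer (absoluteGaloisGroup K) m : Set (absoluteGaloisGroup K)))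
    (hγ : κ.IsTopGenerator γ) : GreenbergStrictSelmerDualDataOf κ γ M L :=
  { X := GreenbergSelmer.strictSelmerInfty κ M L →+ AddCircle (1 : ℚ)
    module := (isLocNil_conjStrictSelmerInftyOf_sub_one κ L htor hstab hγ).module
    toDual := AddMonoidHom.id _
    bijective := Function.bijective_id
    toDual_T_smul := fun x s ↦ by
      show (isLocNil_conjStrictSelmerInftyOf_sub_one κ L htor hstab hγ).smulFun PowerSeries.X x s = x _ - x s
      rw [(isLocNil_conjStrictSelmerInftyOf_sub_one κ L htor hstab hγ).smulFun_X_apply, IwasawaDual.End_sub_apply,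
        AddMonoid.End.one_apply, map_sub]
      rfl
    toDual_C_smul := fun c x s k hk ↦ by
      show (isLocNil_conjStrictSelmerInftyOf_sub_one κ L htor hstab hγ).smulFun (PowerSeries.C c) x s = _
      exact (isLocNil_conjStrictSelmerInftyOf_sub_one κ L htor hstab hγ).smulFun_C_apply c x hk }

variable {γ M} in
/-- **Existence**: for `γ` a topological generator of `Gal(K_∞/K)`, ANY Greenberg local data `L`, and any discrete `p`-primary `Γ_K`-module `M`
with open point stabilisers, `GreenbergStrictSelmerDualDataOf κ γ M L` is inhabited. [cite: Greenberg1989, §1 p. 98] -/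
theorem nonempty_greenbergStrictSelmerDualDataOf (htor : ∀ m : M, ∃ k : ℕ, p ^ k • m = 0)
    (hstab : ∀ m : M, IsOpen (MulAction.stabilizer (absoluteGaloisGroup K) m : Set (absoluteGaloisGroup K)))
    (hγ : κ.IsTopGenerator γ) : Nonempty (GreenbergStrictSelmerDualDataOf κ γ M L) :=
  ⟨greenbergStrictSelmerDualDataOf κ L htor hstab hγ⟩

end Summit.BirchSwinnertonDyer.BirchSwinnertonDyer.Theorems.TwoAdicKatoDeterminant

end
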